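import Literature.GroupTheory.CombinatorialGroupTheory.AmalgamNormalForm
import Literature.GroupTheory.CombinatorialGroupTheory.FiniteAmalgamResiduallyFinite
import Literature.GroupTheory.CombinatorialGroupTheory.ConjugacySeparable
import Mathlib.GroupTheory.OrderOfElement
import HarnessLib

/-!
# Torsion in an amalgam lies in the factors; torsion vs. infinite order is conjugacy-separated

Topic `Literature/GroupTheory/CombinatorialGroupTheory`; theorems only, over Mathlib's amalgamated
product `Monoid.PushoutI φ` and the tree's word calculus (`AmalgamReducedWords`,
`AmalgamNormalForm`) and residual finiteness of finite amalgams (`FiniteAmalgamResiduallyFinite`).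

* `Amalgam.exists_conj_eq_of_of_isOfFinOrder` — **an element of finite order of an amalgam
  `∗_H G_i` (injective `φ_i`) is conjugate into a factor** (Magnus–Karrass–Solitar §4.2, Cor. 4.4.5
  with Thm. 4.6: a cyclically reduced element of length `≥ 2` has infinite order); and the companion
  `Amalgam.not_isOfFinOrder_of_cyclicallyReduced`.
* `exists_normal_finiteIndex_not_isConj_of_isOfFinOrder` — **in a residually finite group an element
  of finite order and an element of infinite order have non-conjugate images in some finite quotient**
  (order bookkeeping: kill none of `y, y², …, y^m`, `m = ord x`).
* `Amalgam.exists_normal_finiteIndex_not_isConj_mixed` — hence in an amalgam of FINITE groups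
  (residually finite by the tree's `pushoutI_residuallyFinite`) every MIXED pair (torsion, infinite
  order) is conjugacy-separated in a finite quotient — the first case of Dyer's theorem "amalgams of
  two finite groups are conjugacy separable" (J. L. Dyer, J. Austral. Math. Soc. (A) 29 (1980)
  Thm. 1, from her 1979 free-by-finite theorem; here brick D1a of the tree's route to Stebe's theorem
  on surface groups, nothing of which is claimed in this file).

SCOPE of what remains for "finite amalgams are c.s." (recorded for the programme, not proved here):
(D1b) torsion–torsion pairs — by the first theorem both lie in factors up to conjugacy, and conjugacy
between factor elements is governed by chains through `H` (MKS Thm. 4.6 (i)(ii); Dyer 1980 Thm. 2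
(1)(2)); (D1c) pairs of infinite order — Dyer 1979 / Stebe 1970 Thm. 2 over a FREE normal subgroup
of finite index (its existence for finite amalgams = B. H. Neumann's permutational product + "free
action on the Bass–Serre tree ⇒ free").

## References

* W. Magnus, A. Karrass, D. Solitar, *Combinatorial Group Theory*, Interscience (1966), §4.2,
  Thm. 4.6 and Cor. 4.4.5. [MagnusKarrassSolitar1966]
* J. L. Dyer, *Separating conjugates in amalgamated free products and HNN extensions*, J. Austral.
  Math. Soc. Ser. A 29 (1980) 35–51, Thm. 1, Thm. 2. [Dyer1980]
-/

namespace Literature.GroupTheory.CombinatorialGroupTheory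

open Monoid Monoid.PushoutI

universe u v w

/-! ### Conjugate elements have the same order (bookkeeping) -/

/-- Conjugate elements have equal order. [folklore] -/
private theorem orderOf_eq_of_isConj {K : Type*} [Group K] {x y : K} (h : IsConj x y) :
    orderOf x = orderOf y := by
  obtain ⟨c, hc⟩ := isConj_iff.1 h
  rw [← hc, ← MulAut.conj_apply, ← MulEquiv.coe_toMonoidHom,
    orderOf_injective (MulAut.conj c).toMonoidHom (MulAut.conj c).injective x]

/-- Being of finite order is a conjugacy invariant. [folklore] -/
private theorem isOfFinOrder_of_isConj {K : Type*} [Group K] {x y : K} (h : IsConj x y)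
    (hx : IsOfFinOrder x) : IsOfFinOrder y := by
  rw [← orderOf_pos_iff] at hx ⊢
  rwa [← orderOf_eq_of_isConj h]

/-! ### Torsion vs. infinite order in a residually finite group -/

/-- **Order bookkeeping**: in a residually finite group `K`, if `x` has finite order and `y` has
infinite order, then some normal subgroup `N` of finite index misses `y, y², …, y^{ord x}`, so that in
`K ⧸ N` the order of `ȳ` exceeds `ord x ≥ ord x̄` and `x̄`, `ȳ` are not conjugate.
[cite: Dyer1980, Thm 1 p.36] -/
theorem exists_normal_finiteIndex_not_isConj_of_isOfFinOrder {K : Type u} [Group K]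
    [Group.ResiduallyFinite K] {x y : K} (hx : IsOfFinOrder x) (hy : ¬ IsOfFinOrder y) :
    ∃ (N : Subgroup K) (_ : N.Normal) (_ : N.FiniteIndex),
      ¬ IsConj (QuotientGroup.mk x : K ⧸ N) (QuotientGroup.mk y) := by
  classical
  set m := orderOf x with hm
  have hm0 : 0 < m := orderOf_pos_iff.2 hx
  -- for each `1 ≤ j ≤ m`, `y ^ j ≠ 1`
  have hyj : ∀ j : ℕ, 0 < j → y ^ j ≠ 1 := fun j hj h =>
    hy (isOfFinOrder_iff_pow_eq_one.2 ⟨j, hj, h⟩)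
  -- normal finite-index subgroups missing these powers
  have hN : ∀ j : Fin m, ∃ N : Subgroup K, N.Normal ∧ N.FiniteIndex ∧ y ^ (j.1 + 1) ∉ N := by
    intro j
    obtain ⟨N, hN⟩ := Group.exists_finiteIndexNormalSubgroup_notMem (y ^ (j.1 + 1))
      (hyj _ (Nat.succ_pos _))
    exact ⟨N.toSubgroup, inferInstance, inferInstance, hN⟩
  choose N hNn hNf hNy using hN
  let M : Subgroup K := ⨅ j, N j
  haveI hMn : M.Normal := Subgroup.normal_iInf_normal fun j => hNn j
  haveI hMf : M.FiniteIndex := by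
    haveI : ∀ j, (N j).FiniteIndex := hNf
    exact Subgroup.finiteIndex_iInf fun j => inferInstance
  refine ⟨M, hMn, hMf, fun hconj => ?_⟩
  -- in `K ⧸ M`: `ord x̄ ∣ m`, but `ȳ ^ j ≠ 1` for `1 ≤ j ≤ m`
  have h1 : orderOf (QuotientGroup.mk x : K ⧸ M) ≤ m := by
    refine Nat.le_of_dvd hm0 ?_
    rw [hm]
    exact orderOf_map_dvd (QuotientGroup.mk' M) x
  have h2 : ∀ j : ℕ, 0 < j → j ≤ m → (QuotientGroup.mk y : K ⧸ M) ^ j ≠ 1 := by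
    intro j hj hjm h
    rw [← QuotientGroup.mk_pow, QuotientGroup.eq_one_iff] at h
    obtain ⟨j', rfl⟩ : ∃ j' : ℕ, j = j' + 1 := ⟨j - 1, by omega⟩
    have hj'm : j' < m := by omega
    exact hNy ⟨j', hj'm⟩ (Subgroup.mem_iInf.1 h ⟨j', hj'm⟩)
  haveI : Finite (K ⧸ M) := Subgroup.finite_quotient_of_finiteIndex
  have hyo : 0 < orderOf (QuotientGroup.mk y : K ⧸ M) := orderOf_pos _
  have h3 : m < orderOf (QuotientGroup.mk y : K ⧸ M) := by
    by_contra h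
    push Not at h
    exact h2 _ hyo h (pow_orderOf_eq_one _)
  have h4 := orderOf_eq_of_isConj hconj
  omega

/-! ### A conjugacy-separable normal subgroup of finite index separates pairs with non-conjugate powers -/

/-- **Powers criterion** (the reduction behind Dyer 1979 / Stebe 1970 Thm. 2 for free-by-finite
groups): let `F ⊴ K` have finite index and be conjugacy separable as an abstract group, and let
`x, y ∈ K` with `x ^ k, y ^ k ∈ F`.  If `x ^ k` and `y ^ k` are NOT conjugate in `K`, then `x` and `y`
have non-conjugate images in some finite quotient of `K`.  (For each coset representative `g` the
elements `x ^ k` and `g y^k g⁻¹` of `F` are not `F`-conjugate; separate them in `F ⧸ M_g`, intersect,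
push to `K` and take the normal core: a conjugacy `d̄ ȳ d̄⁻¹ = x̄` powers to
`f (g y^k g⁻¹) f⁻¹ ≡ x^k` with `d = f g`, `f ∈ F`.) [cite: Dyer1980, Thm 1 p.36] -/
theorem exists_normal_finiteIndex_not_isConj_of_pow {K : Type u} [Group K] (F : Subgroup K)
    [hFn : F.Normal] [F.FiniteIndex]
    (hF : ∀ u w : F, ¬ IsConj u w →
      ∃ (M : Subgroup F) (_ : M.Normal) (_ : M.FiniteIndex),
        ¬ IsConj (QuotientGroup.mk u : F ⧸ M) (QuotientGroup.mk w))
    {x y : K} {k : ℕ} (hxk : x ^ k ∈ F) (hyk : y ^ k ∈ F) (h : ¬ IsConj (x ^ k) (y ^ k)) :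
    ∃ (N : Subgroup K) (_ : N.Normal) (_ : N.FiniteIndex),
      ¬ IsConj (QuotientGroup.mk x : K ⧸ N) (QuotientGroup.mk y) := by
  classical
  haveI : Finite (K ⧸ F) := Subgroup.finite_quotient_of_finiteIndex
  -- coset representatives and the `F`-elements `w q = g_q y^k g_q⁻¹`
  let rep : K ⧸ F → K := fun q => q.out
  have hw : ∀ q : K ⧸ F, rep q * y ^ k * (rep q)⁻¹ ∈ F := fun q => hFn.conj_mem _ hyk _
  -- `x ^ k` is not `F`-conjugate to any `w q`
  have hnc : ∀ q : K ⧸ F, ¬ IsConj (⟨x ^ k, hxk⟩ : F) ⟨rep q * y ^ k * (rep q)⁻¹, hw q⟩ := by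
    intro q hc
    apply h
    obtain ⟨c, hc⟩ := isConj_iff.1 hc
    have hc' : (c : K) * x ^ k * (c : K)⁻¹ = rep q * y ^ k * (rep q)⁻¹ := by
      have := congrArg Subtype.val hc
      simpa using this
    -- `x^k ~ g y^k g⁻¹ ~ y^k`
    refine isConj_iff.2 ⟨(rep q)⁻¹ * c, ?_⟩
    have e : y ^ k = (rep q)⁻¹ * ((c : K) * x ^ k * (c : K)⁻¹) * rep q := by
      rw [hc']; group
    rw [e]; group
  choose M hMn hMf hM using fun q => hF _ _ (hnc q)
  let M₀ : Subgroup F := ⨅ q, M q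
  haveI hM₀n : M₀.Normal := Subgroup.normal_iInf_normal fun q => hMn q
  haveI hM₀f : M₀.FiniteIndex := by
    haveI : ∀ q, (M q).FiniteIndex := hMf
    exact Subgroup.finiteIndex_iInf fun q => inferInstance
  -- push to `K` and take the normal core
  let L : Subgroup K := M₀.map F.subtype
  haveI hLf : L.FiniteIndex := by
    refine ⟨?_⟩
    rw [Subgroup.index_map_subtype]
    exact mul_ne_zero hM₀f.index_ne_zero Subgroup.FiniteIndex.index_ne_zero
  refine ⟨L.normalCore, inferInstance, inferInstance, fun hconj => ?_⟩
  -- a conjugator `d` with `d y d⁻¹ ≡ x`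
  obtain ⟨dbar, hd⟩ := isConj_iff.1 hconj.symm
  obtain ⟨d, rfl⟩ := QuotientGroup.mk_surjective dbar
  have hd' : (QuotientGroup.mk (d * y ^ k * d⁻¹) : K ⧸ L.normalCore) = QuotientGroup.mk (x ^ k) := by
    rw [QuotientGroup.mk_mul, QuotientGroup.mk_mul, QuotientGroup.mk_inv, QuotientGroup.mk_pow,
      ← conj_pow, hd, QuotientGroup.mk_pow]
  -- `d = f * g` with `g = rep (mk d)`, `f ∈ F`
  set q : K ⧸ F := QuotientGroup.mk d with hq
  obtain ⟨f₀, hf₀⟩ := QuotientGroup.mk_out_eq_mul F d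
  have hrep : rep q = d * f₀ := hf₀
  set f : K := d * (f₀ : K)⁻¹ * d⁻¹ with hf
  have hfF : f ∈ F := hFn.conj_mem _ (F.inv_mem f₀.2) _
  have hdf : d = f * rep q := by
    rw [hrep, hf]; group
  -- the relation in `F`: `(x^k)⁻¹ · f w_q f⁻¹ ∈ L.normalCore ≤ L`
  have hrel : (x ^ k)⁻¹ * (f * (rep q * y ^ k * (rep q)⁻¹) * f⁻¹) ∈ L := by
    apply L.normalCore_le
    rw [← QuotientGroup.eq, ← hd', hdf]
    congr 1
    group
  -- pull back to `F`: the element lies in `M₀ ≤ M q`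
  have hmem : (⟨x ^ k, hxk⟩ : F)⁻¹ * (⟨f, hfF⟩ * ⟨rep q * y ^ k * (rep q)⁻¹, hw q⟩ * ⟨f, hfF⟩⁻¹) ∈ M q := by
    obtain ⟨z, hz, hzval⟩ := hrel
    have : z = (⟨x ^ k, hxk⟩ : F)⁻¹ * (⟨f, hfF⟩ * ⟨rep q * y ^ k * (rep q)⁻¹, hw q⟩ * ⟨f, hfF⟩⁻¹) := by
      apply Subtype.ext
      simpa using hzval
    rw [← this]
    exact Subgroup.mem_iInf.1 hz q
  -- contradiction with the choice of `M q`
  apply hM q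
  rw [isConj_comm]
  refine isConj_iff.2 ⟨QuotientGroup.mk ⟨f, hfF⟩, ?_⟩
  rw [← QuotientGroup.mk_mul, ← QuotientGroup.mk_inv, ← QuotientGroup.mk_mul, eq_comm, QuotientGroup.eq]
  exact hmem

/-- The powers criterion with the canonical exponent `k = [K : F]` (so that `x ^ k, y ^ k ∈ F`
automatically). [cite: Dyer1980, Thm 1 p.36] -/
theorem exists_normal_finiteIndex_not_isConj_of_pow_index {K : Type u} [Group K] (F : Subgroup K)
    [F.Normal] [F.FiniteIndex]
    (hF : ∀ u w : F, ¬ IsConj u w →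
      ∃ (M : Subgroup F) (_ : M.Normal) (_ : M.FiniteIndex),
        ¬ IsConj (QuotientGroup.mk u : F ⧸ M) (QuotientGroup.mk w))
    {x y : K} (h : ¬ IsConj (x ^ F.index) (y ^ F.index)) :
    ∃ (N : Subgroup K) (_ : N.Normal) (_ : N.FiniteIndex),
      ¬ IsConj (QuotientGroup.mk x : K ⧸ N) (QuotientGroup.mk y) :=
  exists_normal_finiteIndex_not_isConj_of_pow F hF (F.pow_index_mem x) (F.pow_index_mem y) h


/-- The powers criterion for a CONJUGACY SEPARABLE normal subgroup of finite index (the tree's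
`IsConjugacySeparable`, Stebe's definition). [cite: Dyer1980, Thm 1 p.36] -/
theorem exists_normal_finiteIndex_not_isConj_of_pow_of_isConjugacySeparable {K : Type u} [Group K]
    (F : Subgroup K) [F.Normal] [F.FiniteIndex] (hF : IsConjugacySeparable F)
    {x y : K} {k : ℕ} (hxk : x ^ k ∈ F) (hyk : y ^ k ∈ F) (h : ¬ IsConj (x ^ k) (y ^ k)) :
    ∃ (N : Subgroup K) (_ : N.Normal) (_ : N.FiniteIndex),
      ¬ IsConj (QuotientGroup.mk x : K ⧸ N) (QuotientGroup.mk y) :=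
  exists_normal_finiteIndex_not_isConj_of_pow F (isConjugacySeparable_iff_quotient.1 hF) hxk hyk h

/-- **Free-by-finite groups: pairs with non-conjugate powers are separated** — the powers criterion
for a FREE normal subgroup of finite index (free groups are conjugacy separable:
`isConjugacySeparable_freeGroup`, Stebe 1970 / Lyndon–Schupp I.4.8).  With `k = [K : F]`: if
`x ^ k ≁ y ^ k` in `K` then `x̄ ≁ ȳ` in some finite quotient. [cite: Dyer1980, Thm 1 p.36] -/
theorem exists_normal_finiteIndex_not_isConj_of_pow_of_isFreeGroup {K : Type u} [Group K]
    (F : Subgroup K) [F.Normal] [F.FiniteIndex] [IsFreeGroup F]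
    {x y : K} (h : ¬ IsConj (x ^ F.index) (y ^ F.index)) :
    ∃ (N : Subgroup K) (_ : N.Normal) (_ : N.FiniteIndex),
      ¬ IsConj (QuotientGroup.mk x : K ⧸ N) (QuotientGroup.mk y) :=
  exists_normal_finiteIndex_not_isConj_of_pow_of_isConjugacySeparable F
    ((isConjugacySeparable_freeGroup (IsFreeGroup.Generators F)).of_mulEquiv
      (IsFreeGroup.toFreeGroup F))
    (F.pow_index_mem x) (F.pow_index_mem y) h


namespace Amalgam

variable {ι : Type u} {G : ι → Type v} [∀ i, Group (G i)] {H : Type w} [Group H]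
  {φ : ∀ i, H →* G i}

/-- The value in `PushoutI φ` of a letter list. -/
local notation3 "ℓπ[" φ "] " l:max =>
  List.prod (List.map (fun x => Monoid.PushoutI.of (φ := φ) (Sigma.fst x) (Sigma.snd x)) l)

/-! ### Torsion in an amalgam is conjugate into a factor -/

/-- A cyclically reduced word of length `≥ 2` (alternating factors, no letter in the base group,
end letters in different factors) has a value of INFINITE order (its powers are again reduced
words, hence non-trivial). [cite: MagnusKarrassSolitar1966, §4.2 Thm. 4.6] -/
theorem not_isOfFinOrder_of_cyclicallyReduced (hφ : ∀ i, Function.Injective (φ i))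
    {w : List (Σ i, G i)} (hc : w.IsChain fun a b => a.1 ≠ b.1)
    (hr : ∀ y ∈ w, y.2 ∉ (φ y.1).range) (h2 : 2 ≤ w.length)
    (hcr : ∀ a ∈ w.getLast?, ∀ b ∈ w.head?, a.1 ≠ b.1) : ¬ IsOfFinOrder (ℓπ[φ] w) := by
  intro hfin
  obtain ⟨m, hm, hpow⟩ := isOfFinOrder_iff_pow_eq_one.1 hfin
  have hne : w ≠ [] := by
    intro h; rw [h] at h2; simp at h2
  exact pow_lprod_ne_one hφ hc hr hcr hne hm.ne' hpow

/-- **An element of finite order of an amalgam is conjugate into a factor** (MKS §4.2 Cor. 4.4.5 /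
Thm. 4.6; Dyer 1980 Thm. 2: "any cyclically reduced element … is of minimal length in its conjugacy
class", and cyclically reduced elements of length `≥ 2` have infinite order): if all `φ_i` are
injective and `x ∈ ∗_H G_i` has finite order, then `p x p⁻¹ = of i g` for some `p`, `i`, `g ∈ G_i`.
[cite: MagnusKarrassSolitar1966, §4.2 Cor. 4.4.5] -/
theorem exists_conj_eq_of_of_isOfFinOrder [Nonempty ι] (hφ : ∀ i, Function.Injective (φ i))
    {x : PushoutI φ} (hx : IsOfFinOrder x) :
    ∃ (p : PushoutI φ) (i : ι) (g : G i), p * x * p⁻¹ = of i g := by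
  obtain ⟨p, h | h | h⟩ := exists_conj_normalForm hφ x
  · -- in the base group: `base c = of i (φ i c)` for any `i`
    obtain ⟨c, hc⟩ := h
    obtain ⟨i⟩ := ‹Nonempty ι›
    exact ⟨p, i, φ i c, by rw [hc, of_apply_eq_base]⟩
  · obtain ⟨i, g, -, hg⟩ := h
    exact ⟨p, i, g, hg⟩
  · -- cyclically reduced of length `≥ 2`: infinite order, contradiction
    obtain ⟨w, hc, hr, h2, hcr, hw⟩ := h
    exfalso
    have hfin : IsOfFinOrder (p * x * p⁻¹) :=
      isOfFinOrder_of_isConj (isConj_iff.2 ⟨p, rfl⟩) hx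
    rw [hw] at hfin
    exact not_isOfFinOrder_of_cyclicallyReduced hφ hc hr h2 hcr hfin

/-- Conversely, with FINITE factors every element conjugate into a factor has finite order; so in an
amalgam of finite groups "torsion" = "conjugate into a factor" (the elliptic elements).
[cite: MagnusKarrassSolitar1966, §4.2 Cor. 4.4.5] -/
theorem isOfFinOrder_iff_exists_conj_eq_of [Nonempty ι] [∀ i, Finite (G i)]
    (hφ : ∀ i, Function.Injective (φ i)) (x : PushoutI φ) :
    IsOfFinOrder x ↔ ∃ (p : PushoutI φ) (i : ι) (g : G i), p * x * p⁻¹ = of i g := by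
  refine ⟨exists_conj_eq_of_of_isOfFinOrder hφ, ?_⟩
  rintro ⟨p, i, g, h⟩
  have h1 : IsOfFinOrder (of (φ := φ) i g) := (of i).isOfFinOrder (isOfFinOrder_of_finite g)
  have h2 : IsConj (of (φ := φ) i g) x := by
    rw [← h]
    exact (isConj_iff.2 ⟨p, rfl⟩).symm
  exact isOfFinOrder_of_isConj h2 h1

/-! ### Mixed pairs in an amalgam of finite groups are conjugacy-separated -/

/-- **Brick D1a** (first case of "amalgams of finite groups are conjugacy separable", Dyer 1980
Thm. 1): in `∗_H G_i` with finitely many FINITE factors, a finite `H` and injective `φ_i`, an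
element of finite order and an element of infinite order have non-conjugate images in some finite
quotient. [cite: Dyer1980, Thm 1 p.36] -/
theorem exists_normal_finiteIndex_not_isConj_mixed [Finite ι] [∀ i, Finite (G i)] [Finite H]
    (hφ : ∀ i, Function.Injective (φ i)) {x y : PushoutI φ} (hx : IsOfFinOrder x)
    (hy : ¬ IsOfFinOrder y) :
    ∃ (N : Subgroup (PushoutI φ)) (_ : N.Normal) (_ : N.FiniteIndex),
      ¬ IsConj (QuotientGroup.mk x : PushoutI φ ⧸ N) (QuotientGroup.mk y) := by
  haveI := pushoutI_residuallyFinite (φ := φ) hφ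
  exact exists_normal_finiteIndex_not_isConj_of_isOfFinOrder hx hy

/-- The same with the rôles exchanged (the relation "not conjugate in `K ⧸ N`" is symmetric).
[cite: Dyer1980, Thm 1 p.36] -/
theorem exists_normal_finiteIndex_not_isConj_mixed' [Finite ι] [∀ i, Finite (G i)] [Finite H]
    (hφ : ∀ i, Function.Injective (φ i)) {x y : PushoutI φ} (hx : ¬ IsOfFinOrder x)
    (hy : IsOfFinOrder y) :
    ∃ (N : Subgroup (PushoutI φ)) (_ : N.Normal) (_ : N.FiniteIndex),
      ¬ IsConj (QuotientGroup.mk x : PushoutI φ ⧸ N) (QuotientGroup.mk y) := by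
  obtain ⟨N, hNn, hNf, h⟩ := exists_normal_finiteIndex_not_isConj_mixed hφ hy hx
  exact ⟨N, hNn, hNf, fun h' => h h'.symm⟩

end Amalgam

end Literature.GroupTheory.CombinatorialGroupTheory
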